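import Summits.Parity.BatemanHorn.Cruxes.RoughValueLaw.SketchIdeator3
import Literature.NumberTheory.Sieve.AletheiaZomleferFukshanskyGarcia2020ApplicationsArithProgProofs
import Literature.NumberTheory.LFunctions.RHWave0PNTProofs

/-!
# Crux-triage r1-3, card `scale-free-normal-form`: the stub `Ideator3.valueDepth_equiv` is false at `u = 1`

`valueDepth_equiv` (SketchIdeator3.lean) is stated for ALL `u > 0`.  For the Bateman–Horn system `![X]`
(k = 1) at `u = 1` the crux-side count is `#{1 ≤ n ≤ x : no prime p < ⌈x¹⌉₊ = x divides n} ≤ 2`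
(only `n = 1` and `n = x`), while `valueDepthCount ![X] x 1 = #{1 ≤ n ≤ x : P⁻(n) ≥ n} ≥ π(x)`; by the
prime number theorem (tree: `Literature.NumberTheory.LFunctions.primeCounting_isEquivalent_holds`) the normalised difference tends to
`-1`, not `0`.  Repair: restrict the binder to `1 < u` (the crux only needs `u > 2`).
-/

namespace Summit.Parity.BatemanHorn.Cruxes.RoughValueLaw.Triage3

open Filter Finset Polynomial
open scoped Topology
open Asymptotics
open Literature.NumberTheory.Sieve
open Summit.Parity.BatemanHorn.Cruxes.RoughValueLaw.Ideator3 (valueDepthCount)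

/-- `![X]` is a Bateman–Horn system (the tree's `isBatemanHornSystem_linear 1 0`). -/
theorem isBatemanHornSystem_X : IsBatemanHornSystem ![(X : ℤ[X])] := by
  have h := isBatemanHornSystem_linear 1 0 one_pos (Nat.coprime_one_left 0)
  simpa using h

/-- The prime number theorem along `ℕ`: `π(x) log x / x → 1` (tree:
`Literature.NumberTheory.LFunctions.primeCounting_isEquivalent_holds`). -/
theorem tendsto_primeCounting_mul_log_div_nat :
    Tendsto (fun x : ℕ => (Nat.primeCounting x : ℝ) * Real.log x / x) atTop (𝓝 1) := by
  have h := Literature.NumberTheory.LFunctions.primeCounting_isEquivalent_holds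
  have hne : ∀ᶠ x : ℝ in atTop, x / Real.log x ≠ 0 := by
    filter_upwards [eventually_gt_atTop 1] with x hx
    exact div_ne_zero (by linarith) (Real.log_pos hx).ne'
  have h2 := ((isEquivalent_iff_tendsto_one hne).mp h).comp tendsto_natCast_atTop_atTop
  refine h2.congr' ?_
  filter_upwards [eventually_gt_atTop 1] with x hx
  have hx' : (1 : ℝ) < x := by exact_mod_cast hx
  have hlog : Real.log x ≠ 0 := (Real.log_pos hx').ne'
  have hx0 : (x : ℝ) ≠ 0 := by positivity
  simp only [Function.comp_apply, Pi.div_apply, Nat.floor_natCast]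
  field_simp

/-- The universal closure of the stub `Ideator3.valueDepth_equiv`, verbatim. -/
def ValueDepthEquiv : Prop :=
  ∀ {k : ℕ} (f : Fin k → ℤ[X]), IsBatemanHornSystem f →
    ∀ u : ℝ, 0 < u → Tendsto (fun x : ℕ =>
      ((#((Icc 1 x).filter fun n : ℕ => ∀ i, 0 < (f i).eval (n : ℤ) ∧
          ∀ p ∈ range ⌈(x : ℝ) ^ (((f i).natDegree : ℝ) / u)⌉₊, p.Prime → ¬ ((p : ℤ) ∣ (f i).eval (n : ℤ))) : ℝ)
        - (valueDepthCount f x u : ℝ)) * Real.log x ^ k / x) atTop (nhds 0)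

/-- The crux-side count of `![X]` at depth `u = 1` is at most `2` (only `n = 1` and `n = x` survive). -/
theorem crux_count_X_one_le (x : ℕ) :
    #((Icc 1 x).filter fun n : ℕ => ∀ i, 0 < ((![X] : Fin 1 → ℤ[X]) i).eval (n : ℤ) ∧
        ∀ p ∈ range ⌈(x : ℝ) ^ ((((![X] : Fin 1 → ℤ[X]) i).natDegree : ℝ) / 1)⌉₊, p.Prime →
          ¬ ((p : ℤ) ∣ ((![X] : Fin 1 → ℤ[X]) i).eval (n : ℤ))) ≤ 2 := by
  calc _ ≤ #({1, x} : Finset ℕ) := by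
        apply card_le_card
        intro n hn
        simp only [Fin.forall_fin_one, Matrix.cons_val_fin_one, eval_X, natDegree_X, Nat.cast_one,
          div_one, Real.rpow_one, Nat.ceil_natCast, mem_filter, mem_Icc] at hn
        obtain ⟨⟨h1, hnx⟩, -, hp⟩ := hn
        rw [mem_insert, mem_singleton]
        by_contra hcon
        push Not at hcon
        have hn1 : 1 < n := lt_of_le_of_ne h1 (Ne.symm hcon.1)
        have hnx' : n < x := lt_of_le_of_ne hnx hcon.2
        have hmin : n.minFac.Prime := Nat.minFac_prime (by omega)
        have hle : n.minFac ≤ n := Nat.minFac_le (by omega)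
        exact hp n.minFac (mem_range.mpr (by omega)) hmin (by exact_mod_cast Nat.minFac_dvd n)
    _ ≤ 2 := (card_insert_le _ _).trans (by simp)

/-- Every prime `n ≤ x` is counted by `valueDepthCount ![X] x 1` (its least prime factor is `n ≥ n¹`). -/
theorem primeCounting_le_valueDepthCount_X_one (x : ℕ) :
    Nat.primeCounting x ≤ valueDepthCount ![(X : ℤ[X])] x 1 := by
  rw [← Nat.primesLE_card_eq_primeCounting, Nat.primesLE_eq_filter_range]
  unfold valueDepthCount
  apply card_le_card
  intro n hn
  rw [mem_filter, mem_range] at hn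
  obtain ⟨hnx, hpr⟩ := hn
  simp only [Fin.forall_fin_one, Matrix.cons_val_fin_one, eval_X, Int.cast_natCast, one_div_one,
    Real.rpow_one, mem_filter, mem_Icc]
  refine ⟨⟨hpr.one_le, by omega⟩, by exact_mod_cast hpr.pos, fun p hp hlt hdvd => ?_⟩
  have hlt' : p < n := by exact_mod_cast hlt
  have hdvd' : p ∣ n := by exact_mod_cast hdvd
  rcases (Nat.dvd_prime hpr).mp hdvd' with h | h
  · exact hp.one_lt.ne' h
  · omega

/-- `π(7) = 4`. -/
theorem primeCounting_seven : Nat.primeCounting 7 = 4 := by decide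

/-- **The stub is false as stated.** -/
theorem not_valueDepthEquiv : ¬ ValueDepthEquiv := by
  intro h
  have h1 := h ![(X : ℤ[X])] isBatemanHornSystem_X 1 one_pos
  have hπ := tendsto_primeCounting_mul_log_div_nat
  -- eventually the normalised difference is ≤ -(1/2)·π(x) log x / x
  have hle : ∀ᶠ x : ℕ in atTop,
      ((#((Icc 1 x).filter fun n : ℕ => ∀ i, 0 < ((![X] : Fin 1 → ℤ[X]) i).eval (n : ℤ) ∧
          ∀ p ∈ range ⌈(x : ℝ) ^ ((((![X] : Fin 1 → ℤ[X]) i).natDegree : ℝ) / 1)⌉₊, p.Prime →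
            ¬ ((p : ℤ) ∣ ((![X] : Fin 1 → ℤ[X]) i).eval (n : ℤ))) : ℝ)
        - (valueDepthCount ![(X : ℤ[X])] x 1 : ℝ)) * Real.log x ^ 1 / x
        ≤ -(1 / 2) * ((Nat.primeCounting x : ℝ) * Real.log x / x) := by
    filter_upwards [eventually_ge_atTop 7] with x hx
    have hc : (#((Icc 1 x).filter fun n : ℕ => ∀ i, 0 < ((![X] : Fin 1 → ℤ[X]) i).eval (n : ℤ) ∧
          ∀ p ∈ range ⌈(x : ℝ) ^ ((((![X] : Fin 1 → ℤ[X]) i).natDegree : ℝ) / 1)⌉₊, p.Prime →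
            ¬ ((p : ℤ) ∣ ((![X] : Fin 1 → ℤ[X]) i).eval (n : ℤ))) : ℝ) ≤ 2 := by
      exact_mod_cast crux_count_X_one_le x
    have hv : (Nat.primeCounting x : ℝ) ≤ (valueDepthCount ![(X : ℤ[X])] x 1 : ℝ) := by
      exact_mod_cast primeCounting_le_valueDepthCount_X_one x
    have h4 : (4 : ℝ) ≤ Nat.primeCounting x := by
      have := Nat.monotone_primeCounting hx
      rw [primeCounting_seven] at this
      exact_mod_cast this
    have hx1 : (1 : ℝ) ≤ x := by exact_mod_cast (show 1 ≤ x by omega)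
    have hlog : 0 ≤ Real.log x := Real.log_nonneg hx1
    have hx0 : (0 : ℝ) < x := by linarith
    have hw : 0 ≤ Real.log x / x := div_nonneg hlog hx0.le
    have hdiff : (#((Icc 1 x).filter fun n : ℕ => ∀ i, 0 < ((![X] : Fin 1 → ℤ[X]) i).eval (n : ℤ) ∧
          ∀ p ∈ range ⌈(x : ℝ) ^ ((((![X] : Fin 1 → ℤ[X]) i).natDegree : ℝ) / 1)⌉₊, p.Prime →
            ¬ ((p : ℤ) ∣ ((![X] : Fin 1 → ℤ[X]) i).eval (n : ℤ))) : ℝ)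
        - (valueDepthCount ![(X : ℤ[X])] x 1 : ℝ) ≤ -(1 / 2) * (Nat.primeCounting x : ℝ) := by
      linarith
    calc _ = ((#((Icc 1 x).filter fun n : ℕ => ∀ i, 0 < ((![X] : Fin 1 → ℤ[X]) i).eval (n : ℤ) ∧
          ∀ p ∈ range ⌈(x : ℝ) ^ ((((![X] : Fin 1 → ℤ[X]) i).natDegree : ℝ) / 1)⌉₊, p.Prime →
            ¬ ((p : ℤ) ∣ ((![X] : Fin 1 → ℤ[X]) i).eval (n : ℤ))) : ℝ)
        - (valueDepthCount ![(X : ℤ[X])] x 1 : ℝ)) * (Real.log x / x) := by ring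
      _ ≤ (-(1 / 2) * (Nat.primeCounting x : ℝ)) * (Real.log x / x) :=
          mul_le_mul_of_nonneg_right hdiff hw
      _ = -(1 / 2) * ((Nat.primeCounting x : ℝ) * Real.log x / x) := by ring
  have hlim : Tendsto (fun x : ℕ => -(1 / 2) * ((Nat.primeCounting x : ℝ) * Real.log x / x)) atTop
      (𝓝 (-(1 / 2) * 1)) := hπ.const_mul _
  have := le_of_tendsto_of_tendsto h1 hlim hle
  norm_num at this

end Summit.Parity.BatemanHorn.Cruxes.RoughValueLaw.Triage3

#print axioms Summit.Parity.BatemanHorn.Cruxes.RoughValueLaw.Triage3.not_valueDepthEquiv
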